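import Mathlib
import HarnessLib
import Literature.Geometry.DiscreteGeometry.KissingPatterns

/-!
# FrustratedLawDichotomy · crux `AperiodicFrustratedLawGap` (stmt-AtomisticToContinuum-27623) — ROBUST GOODNESS IS AN OPEN CONDITION
# in the local matching topology (decomp-a2c, prover hand 2, structural share, generation 7; route-independent module)

Companion of `FrustratedLawDichotomyLocalCloseOrder` (the local-close-order door `LCO → R_GSC`).  A ROBUSTLY GOOD atom `p` of a point set
`Y ⊆ ℝ³` for a pattern `Pat` of unit vectors (the fcc or hcp kissing pattern) is given by a scale `d > 0`, a tolerance `η < 1/20`, a gap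
`γ > 0`, a linear isometry `A` and shell atoms `t : Pat → ℝ³` with: `t u ∈ Y` and `‖(t u − p) − d•A u‖ ≤ η·d`; `d` is the nearest-neighbour
distance of `p` in `Y` (`d ≤ dist s p` for all atoms `s ≠ p`, attained up to `≤`); and the shell sphere is clean (every atom `s ≠ p` with
`dist s p < 13/10·d + γ` has `dist s p ≤ 13/10·d − γ` and is some `t u`) — the clause shape of
`FrustratedLawDichotomyTextureAllBad.not_robustGood_of_texture` with `s ∈ Y` for `μ {s} ≠ 0`.

`robustGood_transfer`: if `Y'` is `7/10`-separated and two-way `ε`-matched with `Y` on the closed ball of radius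
`R ≥ ‖p‖ + 13/10·d + γ + ε` about `0` (the two clauses of `Literature…BallMatch ε R 0 Y' Y`, written with `‖·‖`), and `ε > 0` is small
(`10ε ≤ γ`, `10ε ≤ (1/20 − η)·d`, `4ε < 7/10`), then the atom `p'` of `Y'` matched to `p` is robustly good in `Y'` for the same pattern and
isometry, with scale `d'`, `|d' − d| ≤ 2ε`, tolerance `(1/20 + η)/2` and gap `γ/2`.  Hence robust goodness (with its parameters degraded by an
explicit, `ε`-independent amount) survives local limits in either direction; `FrustratedLawDichotomyLocalCloseOrderUniform` uses it to upgrade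
`LCO` («every rooted separated exact μ-equilibrium of `V_LJ` has a robustly good atom») to a UNIFORM statement by compactness.
`[folklore]` (elementary metric bookkeeping).
-/

noncomputable section

namespace Summit.AtomisticToContinuum.Crystallization.Theorems.FrustratedLawDichotomyLocalCloseOrderStability

open Literature.Geometry.DiscreteGeometry

/-- Shell bounds: if `‖(q − p) − d•v‖ ≤ η·d` with `‖v‖ = 1` and `d ≥ 0` then `d − η·d ≤ dist q p ≤ d + η·d`. [folklore] -/
theorem dist_shell_bounds {p q v : EuclideanSpace ℝ (Fin 3)} {d η : ℝ} (hv : ‖v‖ = 1) (hd : 0 ≤ d)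
    (h : ‖(q - p) - d • v‖ ≤ η * d) : d - η * d ≤ dist q p ∧ dist q p ≤ d + η * d := by
  have h1 : ‖d • v‖ = d := by rw [norm_smul, hv, mul_one, Real.norm_of_nonneg hd]
  have h2 : |‖q - p‖ - ‖d • v‖| ≤ ‖(q - p) - d • v‖ := abs_norm_sub_norm_le _ _
  rw [h1] at h2
  rw [dist_eq_norm]
  constructor <;> linarith [(abs_le.1 (h2.trans h)).1, (abs_le.1 (h2.trans h)).2]

/-- In a `7/10`-separated set two atoms at distance `< 7/10` coincide. [folklore] -/
theorem eq_of_dist_lt {Y : Set (EuclideanSpace ℝ (Fin 3))}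
    (hY : ∀ a ∈ Y, ∀ b ∈ Y, a ≠ b → (7 : ℝ) / 10 ≤ dist a b) {a b : EuclideanSpace ℝ (Fin 3)}
    (ha : a ∈ Y) (hb : b ∈ Y) (h : dist a b < 7 / 10) : a = b := by
  by_contra hne
  exact absurd (hY a ha b hb hne) (not_le.2 h)

/-- **ROBUST GOODNESS TRANSFERS ACROSS A FINE TWO-WAY MATCHING** (see the module docstring for the reading).  Hypotheses: `Y'` is
`7/10`-separated; every atom of `Y` (resp. `Y'`) of norm `≤ R` has an atom of `Y'` (resp. `Y`) within `ε`; `p ∈ Y` is robustly good for the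
pattern `Pat` of unit vectors (nonempty) with data `(d, η, γ, A, t)` (`γ > 0` is implied by `10ε ≤ γ`); `ε > 0`, `10ε ≤ γ`, `10ε ≤ (1/20 − η)·d`, `4ε < 7/10`,
`‖p‖ + 13/10·d + γ + ε ≤ R`.  Conclusion: some `p' ∈ Y'` with `dist p' p ≤ ε` is robustly good in `Y'` with data
`(d', (1/20 + η)/2, γ/2, A, t')`, `|d' − d| ≤ 2ε`. [folklore] -/
theorem robustGood_transfer {Y Y' : Set (EuclideanSpace ℝ (Fin 3))} {ε R : ℝ} {p : EuclideanSpace ℝ (Fin 3)}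
    (hY' : ∀ a ∈ Y', ∀ b ∈ Y', a ≠ b → (7 : ℝ) / 10 ≤ dist a b)
    (hm₁ : ∀ s ∈ Y, ‖s‖ ≤ R → ∃ a ∈ Y', dist a s ≤ ε)
    (hm₂ : ∀ a ∈ Y', ‖a‖ ≤ R → ∃ s ∈ Y, dist a s ≤ ε)
    {Pat : Finset (EuclideanSpace ℝ (Fin 3))} (hPat : Pat.Nonempty) (hPatn : ∀ u ∈ Pat, ‖u‖ = 1)
    {d η γ : ℝ} {A : EuclideanSpace ℝ (Fin 3) →ₗᵢ[ℝ] EuclideanSpace ℝ (Fin 3)} {t : ↥Pat → EuclideanSpace ℝ (Fin 3)}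
    (hp : p ∈ Y) (hd : 0 < d) (hη : η < 1 / 20)
    (ht : ∀ u : ↥Pat, t u ∈ Y ∧ ‖(t u - p) - d • A (u : EuclideanSpace ℝ (Fin 3))‖ ≤ η * d)
    (hnn₁ : ∀ s ∈ Y, s ≠ p → d ≤ dist s p) (hnn₂ : ∃ s ∈ Y, s ≠ p ∧ dist s p ≤ d)
    (hgap : ∀ s ∈ Y, s ≠ p → dist s p < 13 / 10 * d + γ → dist s p ≤ 13 / 10 * d - γ ∧ s ∈ Set.range t)
    (hε : 0 < ε) (hεγ : 10 * ε ≤ γ) (hεη : 10 * ε ≤ (1 / 20 - η) * d) (hε7 : 4 * ε < 7 / 10)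
    (hR : ‖p‖ + 13 / 10 * d + γ + ε ≤ R) :
    ∃ p' ∈ Y', dist p' p ≤ ε ∧ ∃ (d' : ℝ) (t' : ↥Pat → EuclideanSpace ℝ (Fin 3)), |d' - d| ≤ 2 * ε ∧ 0 < d' ∧
      (∀ u : ↥Pat, t' u ∈ Y' ∧ ‖(t' u - p') - d' • A (u : EuclideanSpace ℝ (Fin 3))‖ ≤ (1 / 20 + η) / 2 * d') ∧
      (∀ s ∈ Y', s ≠ p' → d' ≤ dist s p') ∧ (∃ s ∈ Y', s ≠ p' ∧ dist s p' ≤ d') ∧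
      (∀ s ∈ Y', s ≠ p' → dist s p' < 13 / 10 * d' + γ / 2 → dist s p' ≤ 13 / 10 * d' - γ / 2 ∧ s ∈ Set.range t') := by
  -- norms of the pattern vectors after the isometry
  have hAu : ∀ u : ↥Pat, ‖A (u : EuclideanSpace ℝ (Fin 3))‖ = 1 := fun u => by rw [A.norm_map]; exact hPatn u u.2
  -- `η ≥ 0` (the pattern is nonempty), hence `d ≥ 200 ε`
  obtain ⟨u₀, hu₀⟩ := hPat
  have hη0 : 0 ≤ η := by
    have := (norm_nonneg _).trans (ht ⟨u₀, hu₀⟩).2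
    nlinarith
  have hdε : 200 * ε ≤ d := by nlinarith
  -- shell atoms of `Y`: distances to `p`
  have hshell : ∀ u : ↥Pat, d ≤ dist (t u) p ∧ dist (t u) p ≤ 13 / 10 * d - γ := by
    intro u
    have hb := dist_shell_bounds (hAu u) hd.le (ht u).2
    have hne : t u ≠ p := by
      intro h
      have : dist (t u) p = 0 := by rw [h, dist_self]
      nlinarith [hb.1]
    have hlt : dist (t u) p < 13 / 10 * d + γ := by nlinarith [hb.2]
    exact ⟨hnn₁ _ (ht u).1 hne, (hgap _ (ht u).1 hne hlt).1⟩
  have htnorm : ∀ u : ↥Pat, ‖t u‖ ≤ R := by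
    intro u
    have h1 : ‖t u‖ ≤ ‖p‖ + dist (t u) p := by
      rw [dist_eq_norm]
      have := norm_add_le p (t u - p)
      rwa [add_sub_cancel] at this
    linarith [(hshell u).2]
  -- the matched centre and the matched shell
  have hpR : ‖p‖ ≤ R := by nlinarith [norm_nonneg p]
  obtain ⟨p', hp'Y, hp'p⟩ := hm₁ p hp hpR
  choose t' ht'Y ht't using fun u : ↥Pat => hm₁ (t u) (ht u).1 (htnorm u)
  -- distances of the matched shell atoms to the matched centre
  have hdist' : ∀ u : ↥Pat, |dist (t' u) p' - dist (t u) p| ≤ 2 * ε := by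
    intro u
    rw [abs_le]
    constructor
    · have := dist_triangle4 (t u) (t' u) p' p
      rw [dist_comm (t u) (t' u)] at this
      linarith [ht't u, hp'p]
    · have := dist_triangle4 (t' u) (t u) p p'
      rw [dist_comm p p'] at this
      linarith [ht't u, hp'p]
  -- KEY: near `p'`, every atom of `Y'` is a matched shell atom
  have hkey : ∀ s ∈ Y', s ≠ p' → dist s p' < 13 / 10 * d + γ - 2 * ε →
      ∃ u : ↥Pat, s = t' u ∧ dist s p' ≤ dist (t u) p + 2 * ε ∧ dist (t u) p - 2 * ε ≤ dist s p' := by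
    intro s hs hsp hlt
    have hsR : ‖s‖ ≤ R := by
      have h1 : ‖s‖ ≤ ‖p'‖ + dist s p' := by
        rw [dist_eq_norm]
        have := norm_add_le p' (s - p')
        rwa [add_sub_cancel] at this
      have h2 : ‖p'‖ ≤ ‖p‖ + dist p' p := by
        rw [dist_eq_norm]
        have := norm_add_le p (p' - p)
        rwa [add_sub_cancel] at this
      linarith
    obtain ⟨s₀, hs₀Y, hs₀⟩ := hm₂ s hs hsR
    have hs₀p : s₀ ≠ p := by
      intro h
      rw [h] at hs₀
      have : dist s p' < 7 / 10 := by
        have := dist_triangle s p p'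
        rw [dist_comm p p'] at this
        linarith
      exact hsp (eq_of_dist_lt hY' hs hp'Y this)
    have hs₀lt : dist s₀ p < 13 / 10 * d + γ := by
      have := dist_triangle4 s₀ s p' p
      rw [dist_comm s₀ s] at this
      linarith
    obtain ⟨-, u, hu⟩ := hgap s₀ hs₀Y hs₀p hs₀lt
    subst hu
    refine ⟨u, ?_, ?_, ?_⟩
    · apply eq_of_dist_lt hY' hs (ht'Y u)
      have := dist_triangle s (t u) (t' u)
      rw [dist_comm (t u) (t' u)] at this
      linarith [ht't u]
    · have := dist_triangle4 s (t u) p p'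
      rw [dist_comm p p'] at this
      linarith
    · have := dist_triangle4 (t u) s p' p
      rw [dist_comm (t u) s] at this
      linarith [hp'p]
  -- the new scale: the minimal shell distance, attained at `u₁`
  obtain ⟨u₁, -, hu₁⟩ := Finset.exists_min_image Finset.univ (fun u : ↥Pat => dist (t' u) p') ⟨⟨u₀, hu₀⟩, Finset.mem_univ _⟩
  set d' : ℝ := dist (t' u₁) p' with hd'
  -- `|d' - d| ≤ 2ε`
  obtain ⟨s₂, hs₂Y, hs₂p, hs₂d⟩ := hnn₂
  have hs₂lt : dist s₂ p < 13 / 10 * d + γ := by nlinarith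
  obtain ⟨-, u₂, hu₂⟩ := hgap s₂ hs₂Y hs₂p hs₂lt
  have hd'le : d' ≤ d + 2 * ε := by
    have h1 : d' ≤ dist (t' u₂) p' := hu₁ u₂ (Finset.mem_univ _)
    have h2 := (abs_le.1 (hdist' u₂)).2
    rw [hu₂] at h2
    linarith
  have hd'ge : d - 2 * ε ≤ d' := by
    have h2 := (abs_le.1 (hdist' u₁)).1
    linarith [(hshell u₁).1]
  have hd'pos : 0 < d' := by linarith
  refine ⟨p', hp'Y, hp'p, d', t', abs_le.2 ⟨by linarith, by linarith⟩, hd'pos, fun u => ⟨ht'Y u, ?_⟩, ?_, ?_, ?_⟩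
  · -- the fit at the new scale
    have hdec : (t' u - p') - d' • A (u : EuclideanSpace ℝ (Fin 3)) =
        ((t u - p) - d • A (u : EuclideanSpace ℝ (Fin 3))) + (t' u - t u) + (p - p') +
          (d - d') • A (u : EuclideanSpace ℝ (Fin 3)) := by
      rw [sub_smul]; abel
    have h1 : ‖(t' u - p') - d' • A (u : EuclideanSpace ℝ (Fin 3))‖ ≤ η * d + ε + ε + 2 * ε := by
      rw [hdec]
      refine (norm_add_le _ _).trans (add_le_add ((norm_add_le _ _).trans (add_le_add ((norm_add_le _ _).trans
        (add_le_add (ht u).2 ?_)) ?_)) ?_)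
      · rw [← dist_eq_norm]; exact ht't u
      · rw [← dist_eq_norm, dist_comm]; exact hp'p
      · rw [norm_smul, hAu u, mul_one, Real.norm_eq_abs]
        exact abs_le.2 ⟨by linarith, by linarith⟩
    have h2 : η * d + 4 * ε ≤ (1 / 20 + η) / 2 * d' := by nlinarith
    linarith
  · -- `d'` is the nearest-neighbour distance of `p'`
    intro s hs hsp
    by_cases hlt : dist s p' < 13 / 10 * d + γ - 2 * ε
    · obtain ⟨u, hu, -, -⟩ := hkey s hs hsp hlt
      rw [hu]; exact hu₁ u (Finset.mem_univ _)
    · push Not at hlt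
      linarith
  · refine ⟨t' u₁, ht'Y u₁, fun h => ?_, le_rfl⟩
    have : d' = 0 := by rw [hd', h, dist_self]
    linarith
  · -- the clean gap at the new scale
    intro s hs hsp hlt
    have hlt' : dist s p' < 13 / 10 * d + γ - 2 * ε := by nlinarith
    obtain ⟨u, hu, hle, -⟩ := hkey s hs hsp hlt'
    refine ⟨?_, ⟨u, hu.symm⟩⟩
    nlinarith [(hshell u).2]

end Summit.AtomisticToContinuum.Crystallization.Theorems.FrustratedLawDichotomyLocalCloseOrderStability

end
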